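import Mathlib
import Summits.NavierStokesRegularity.NavierStokesRegularity.Theorems.FilamentSkeletonRssSelectionBoxRJRungPicardFixedPoint
import Summits.NavierStokesRegularity.NavierStokesRegularity.Theorems.FilamentSkeletonRssSelectionBoxRJRungModelArcZero

/-!
# Route `FilamentSkeletonRss` · crux `SelectionBoxRJ` (stmt-NavierStokesRegularity-21220) — RUNG 2 (clauses at `C⁰` level):
# the true-partner cut-off local-induction arc carries the skeleton-level clauses and a supercritical-side zero

Lane `ns-filament-19175-p1` (g7); helper file `--supports stmt-NavierStokesRegularity-21220`, route-independent.

`truePartnerArc_rung` upgrades RUNG 1 (`…RungModelArc.modelArc_rung`, frozen partner) to the arc of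
`…RungPicardFixedPoint.truePartnerArc_exists`, whose partner interaction is the TRUE regularised Biot–Savart field of its
own `R_π`-image.  For `0 < Rb ≤ 1/500`, `Γ ≥ exp(Rb⁻²)`, `0 < η ≤ 7/(Γ log Γ)` it certifies: `C²`, unit speed, the nonlocal
cut-off equation, tangent within `1/3000` of `e`, curvature `‖x″‖√Γ ≤ 1`, straight arms (clause 2); radial growth
`‖x t‖ ≥ (2999/3000)|t|`, properness, chord–arc `½|τ − σ|` (clause 3); separation `(39/100)√Γ` from the partner
`R_π ∘ x` (clause 3, `ρ = 39/100`); MODEL TANGENCY on the ball with the TRUE partner field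
(`V(x) + f + η⁻¹ x′ × x″ = w x′`, `f t = (Γ·4/(4π))·u[R_π∘x](x t)`; clause 8 up to the local-induction self-term); and for
the slip `w = ⟪x′, V(x) + f⟫`: `w` is continuous, `w(−(9/20)√Γ) < 0 < w(−(7/20)√Γ)`, so a stagnation zero `c₀` EXISTS in
`(−(9/20)√Γ, −(7/20)√Γ)` with waist `‖x c₀‖ ≤ √Γ/2` (clause 9) and tilt `|⟪x′ c₀, e₃⟫| ≤ 1 − 1/5` (clause 10), and `w > 0`
on `[0, ∞)` — via the R1 zero lemmas with the `C⁰` input `ε₀ = 28/3000` of `…RungPartnerClose`.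

WHAT IS MISSING FOR CLAUSE 11 PROPER (uniqueness of the zero on `ℝ` and the slope window `w′(c₀) ∈ [3/2 + δ, Λ]`): the
`C¹` input `‖f′ − U′‖ ≤ ε₁`, i.e. a curve-Lipschitz estimate for the GRADIENT of the regularised Biot–Savart field (not in
the tree).  The self-induction is still modelled by local induction (R3 owes the LIA remainder).  NOT an instance of
`SelectionBoxRJ`; nothing here is a claim about Navier–Stokes regularity or blow-up.
-/

set_option linter.dupNamespace false -- `Theorems.…Theorems`-style path/namespace repetition is the tree convention

noncomputable section

namespace Summit.NavierStokesRegularity.NavierStokesRegularity.Theorems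

open Set Function Filter MeasureTheory Real Metric
open Literature.Analysis.FluidPDE
open scoped InnerProductSpace Topology

namespace SelectionBoxRJRung

/-- **RUNG 2 at `C⁰` level.**  See the module docstring. [folklore] -/
theorem truePartnerArc_rung {Γ Rb η : ℝ} (hRb0 : 0 < Rb) (hRb : Rb ≤ 1 / 500) (hΓ : Real.exp (1 / Rb ^ 2) ≤ Γ)
    (hη0 : 0 < η) (hη : η * (Γ * Real.log Γ) ≤ 7) :
    ∃ (χ : ℝ → ℝ) (x : ℝ → EuclideanSpace ℝ (Fin 3)) (f : ℝ → EuclideanSpace ℝ (Fin 3)) (w : ℝ → ℝ) (c₀ : ℝ),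
      ((∀ n : ℕ∞, ContDiff ℝ n χ) ∧ (∀ t, |t| ≤ 11 / 10 * (Rb * Real.sqrt (Γ * Real.log Γ)) → χ t = 1) ∧
        (∀ t, 6 / 5 * (Rb * Real.sqrt (Γ * Real.log Γ)) ≤ |t| → χ t = 0) ∧ (∀ t, 0 ≤ χ t ∧ χ t ≤ 1)) ∧
      -- the TRUE partner forcing along `x` and the nonlocal cut-off local-induction equation
      ((∀ t, f t = (Γ * 4 / (4 * Real.pi)) • ∫ σ : ℝ,
          ((‖x t - ((2 * ⟪x σ, EuclideanSpace.single 2 1⟫_ℝ) • (EuclideanSpace.single (2 : Fin 3) (1 : ℝ)) - x σ)‖ ^ 2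
              + 1) ^ (3 / 2 : ℝ))⁻¹ •
            cross (deriv (fun u => (2 * ⟪x u, EuclideanSpace.single 2 1⟫_ℝ) •
                (EuclideanSpace.single (2 : Fin 3) (1 : ℝ)) - x u) σ)
              (x t - ((2 * ⟪x σ, EuclideanSpace.single 2 1⟫_ℝ) • (EuclideanSpace.single (2 : Fin 3) (1 : ℝ)) - x σ))) ∧
        ContDiff ℝ 2 x ∧ x 0 = WithLp.toLp 2 ![Real.sqrt Γ / 5, 0, 0] ∧
        deriv x 0 = WithLp.toLp 2 ![0, (Real.sqrt 2)⁻¹, (Real.sqrt 2)⁻¹] ∧ (∀ t, ‖deriv x t‖ = 1) ∧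
        (∀ t, iteratedDeriv 2 x t = (η * χ t) • cross (deriv x t)
          ((1 / 2 : ℝ) • x t - (21 / 5 : ℝ) • cross (EuclideanSpace.single 2 1) (x t) + f t))) ∧
      -- near-straightness, curvature (clause 2), straight arms
      ((∀ t, ‖deriv x t - WithLp.toLp 2 ![0, (Real.sqrt 2)⁻¹, (Real.sqrt 2)⁻¹]‖ ≤ 1 / 3000) ∧
        (∀ t, ‖iteratedDeriv 2 x t‖ * Real.sqrt Γ ≤ 1) ∧
        (∀ t, 6 / 5 * (Rb * Real.sqrt (Γ * Real.log Γ)) ≤ |t| → iteratedDeriv 2 x t = 0)) ∧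
      -- radial growth, properness, chord–arc, separation from the partner `R_π ∘ x` (clause 3)
      ((∀ t, 2999 / 3000 * |t| ≤ ‖x t‖) ∧ Tendsto (fun t => ‖x t‖) (cocompact ℝ) atTop ∧
        (∀ τ σ, 1 / 2 * |τ - σ| ≤ ‖x τ - x σ‖) ∧
        (∀ τ σ, 39 / 100 * Real.sqrt Γ ≤
          ‖x τ - ((2 * ⟪x σ, EuclideanSpace.single 2 1⟫_ℝ) • (EuclideanSpace.single (2 : Fin 3) (1 : ℝ)) - x σ)‖)) ∧
      -- the slip against the TRUE partner field and MODEL TANGENCY on the ball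
      ((∀ t, w t = ⟪deriv x t,
          ((1 / 2 : ℝ) • x t - (21 / 5 : ℝ) • cross (EuclideanSpace.single 2 1) (x t)) + f t⟫_ℝ) ∧ Continuous w ∧
        (∀ t, ‖x t‖ ≤ Rb * Real.sqrt (Γ * Real.log Γ) →
          ((1 / 2 : ℝ) • x t - (21 / 5 : ℝ) • cross (EuclideanSpace.single 2 1) (x t)) + f t +
              η⁻¹ • cross (deriv x t) (iteratedDeriv 2 x t) = w t • deriv x t)) ∧
      -- the stagnation zero at `C⁰` level: signs, existence and location, waist (9), tilt (10), no zero on `[0, ∞)`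
      (w (-(9 / 20) * Real.sqrt Γ) < 0 ∧ 0 < w (-(7 / 20) * Real.sqrt Γ) ∧ w c₀ = 0 ∧
        -(9 / 20) * Real.sqrt Γ < c₀ ∧ c₀ < -(7 / 20) * Real.sqrt Γ ∧ ‖x c₀‖ ≤ 1 / 2 * Real.sqrt Γ ∧
        |⟪deriv x c₀, EuclideanSpace.single 2 1⟫_ℝ| ≤ 1 - 1 / 5 ∧ (∀ t, 0 ≤ t → 0 < w t)) := by
  obtain ⟨hΓ4, hS₂0, -, -, -, -⟩ := picard_constants hRb0 hRb hΓ hη0 hη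
  have hΓ0 : 0 < Γ := by linarith [show (0:ℝ) < 10 ^ 4 by norm_num]
  have hG : 0 < Real.sqrt Γ := Real.sqrt_pos.2 hΓ0
  obtain ⟨χ, x, ⟨hχs, hχ1, hχ0, hχ01⟩, ⟨hxc, hx0, hx0', hxu, hxode⟩, hnear, hcurv, harm⟩ :=
    truePartnerArc_exists hRb0 hRb hΓ hη0 hη
  have hxd : Differentiable ℝ x := hxc.differentiable (by norm_num)
  have hx1 : ContDiff ℝ 1 x := hxc.of_le (by norm_num)
  -- the true partner forcing along `x`
  set f : ℝ → EuclideanSpace ℝ (Fin 3) := fun t => (Γ * 4 / (4 * Real.pi)) • ∫ σ : ℝ,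
      ((‖x t - ((2 * ⟪x σ, EuclideanSpace.single 2 1⟫_ℝ) • (EuclideanSpace.single (2 : Fin 3) (1 : ℝ)) - x σ)‖ ^ 2
          + 1) ^ (3 / 2 : ℝ))⁻¹ •
        cross (deriv (fun u => (2 * ⟪x u, EuclideanSpace.single 2 1⟫_ℝ) •
            (EuclideanSpace.single (2 : Fin 3) (1 : ℝ)) - x u) σ)
          (x t - ((2 * ⟪x σ, EuclideanSpace.single 2 1⟫_ℝ) • (EuclideanSpace.single (2 : Fin 3) (1 : ℝ)) - x σ))
    with hfdef
  have hfc : Continuous f :=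
    (partnerForcing_continuous (θ := 1 / 3000) hΓ0 (by norm_num) hx1 (fun u => (hxu u).le) hx0 hnear).const_smul
      (Γ * 4 / (4 * Real.pi))
  -- the frozen forcing and the `C⁰` closeness `ε₀ = 28/3000`
  set U : ℝ → EuclideanSpace ℝ (Fin 3) := fun t => (2 * Γ / Real.pi / (4 * Γ / 25 + 1 + t ^ 2)) •
      ((2 * Real.sqrt Γ / 5) • (WithLp.toLp 2 ![0, (Real.sqrt 2)⁻¹, (Real.sqrt 2)⁻¹] : EuclideanSpace ℝ (Fin 3)) -
        t • WithLp.toLp 2 ![(1:ℝ), 0, 0]) with hUdef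
  have hU : ∀ t, U t = (2 * Γ / Real.pi / (4 * Γ / 25 + 1 + t ^ 2)) •
      ((2 * Real.sqrt Γ / 5) • (WithLp.toLp 2 ![0, (Real.sqrt 2)⁻¹, (Real.sqrt 2)⁻¹] : EuclideanSpace ℝ (Fin 3)) -
        t • WithLp.toLp 2 ![(1:ℝ), 0, 0]) := fun t => rfl
  have hf0 : ∀ t, ‖f t - U t‖ ≤ 28 * (1 / 3000) * Real.sqrt Γ := fun t =>
    partnerField_sub_U_le (θ := 1 / 3000) hΓ0 (by norm_num) (by norm_num) U hU hx1 hxu hx0 hnear t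
  -- the slip
  set w : ℝ → ℝ := fun t => ⟪deriv x t,
      ((1 / 2 : ℝ) • x t - (21 / 5 : ℝ) • cross (EuclideanSpace.single 2 1) (x t)) + f t⟫_ℝ with hwdef
  have hw : ∀ t, w t = ⟪deriv x t,
      ((1 / 2 : ℝ) • x t - (21 / 5 : ℝ) • cross (EuclideanSpace.single 2 1) (x t)) + f t⟫_ℝ := fun t => rfl
  have hwc : Continuous w := by
    have h1 : Continuous (deriv x) := hxc.continuous_deriv (by norm_num)
    have h2 : Continuous (fun t => ((1 / 2 : ℝ) • x t -
        (21 / 5 : ℝ) • cross (EuclideanSpace.single (2 : Fin 3) (1 : ℝ)) (x t)) + f t) := by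
      have hcr : Continuous (fun t => cross (EuclideanSpace.single (2 : Fin 3) (1 : ℝ)) (x t)) := by
        have : (fun t => cross (EuclideanSpace.single (2 : Fin 3) (1 : ℝ)) (x t)) =
            fun t => crossCLM (EuclideanSpace.single (2 : Fin 3) (1 : ℝ)) (x t) := by funext t; rw [crossCLM_apply]
        rw [this]; exact (crossCLM _).continuous.comp hxd.continuous
      exact ((hxd.continuous.const_smul (1 / 2 : ℝ)).sub (hcr.const_smul (21 / 5 : ℝ))).add hfc
    exact h1.inner h2
  -- signs, zero, positivity on `[0, ∞)`
  have hneg := slip_neg_at (θ := 1 / 3000) (ε₀ := 28 * (1 / 3000)) hΓ4 (by norm_num) (by norm_num) (by norm_num)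
    U hU hxd hxu hx0 hnear hf0 w hw
  have hpos := slip_pos_at (θ := 1 / 3000) (ε₀ := 28 * (1 / 3000)) hΓ4 (by norm_num) (by norm_num) (by norm_num)
    U hU hxd hxu hx0 hnear hf0 w hw
  have hposR : ∀ t, 0 ≤ t → 0 < w t := fun t ht =>
    slip_pos_of_nonneg (θ := 1 / 3000) (ε₀ := 28 * (1 / 3000)) hΓ4 (by norm_num) (by norm_num) (by norm_num)
      U hU hxd hxu hx0 hnear hf0 w hw ht
  have hab : -(9 / 20) * Real.sqrt Γ ≤ -(7 / 20) * Real.sqrt Γ := by nlinarith only [hG]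
  obtain ⟨c₀, hc₀mem, hc₀⟩ := intermediate_value_Ioo hab hwc.continuousOn ⟨hneg, hpos⟩
  obtain ⟨hc1, hc2⟩ := hc₀mem
  -- radial growth, properness, chord–arc, separation
  have hrad : ∀ t, 2999 / 3000 * |t| ≤ ‖x t‖ := fun t => by
    have := arc_norm_ge (θ := 1 / 3000) hΓ0.le hxd hx0 hnear t; norm_num at this ⊢; linarith
  have hproper : Tendsto (fun t => ‖x t‖) (cocompact ℝ) atTop := by
    have h1 : Tendsto (fun t : ℝ => 2999 / 3000 * ‖t‖) (cocompact ℝ) atTop :=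
      tendsto_norm_cocompact_atTop.const_mul_atTop (by norm_num)
    refine tendsto_atTop_mono (fun t => ?_) h1
    rw [Real.norm_eq_abs]; exact hrad t
  have hsep : ∀ τ σ, 39 / 100 * Real.sqrt Γ ≤
      ‖x τ - ((2 * ⟪x σ, EuclideanSpace.single 2 1⟫_ℝ) • (EuclideanSpace.single (2 : Fin 3) (1 : ℝ)) - x σ)‖ :=
    fun τ σ => by
    have h := (nearStraight_sep_rot (θ := 1 / 3000) hΓ0 (by norm_num) (by norm_num) hxd hx0 hnear τ σ).1
    have : 39 / 100 * Real.sqrt Γ ≤ (1 - 2 * (1 / 3000)) * (2 * Real.sqrt Γ / 5) := by nlinarith only [hG]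
    exact this.trans h
  have hchord : ∀ τ σ, 1 / 2 * |τ - σ| ≤ ‖x τ - x σ‖ := by
    intro τ σ
    have he1 : ‖(WithLp.toLp 2 ![0, (Real.sqrt 2)⁻¹, (Real.sqrt 2)⁻¹] : EuclideanSpace ℝ (Fin 3))‖ = 1 := norm_tangent₁
    have hg : ∀ t, HasDerivAt (fun s => ⟪x s, (WithLp.toLp 2 ![0, (Real.sqrt 2)⁻¹, (Real.sqrt 2)⁻¹] :
        EuclideanSpace ℝ (Fin 3))⟫_ℝ) ⟪deriv x t, (WithLp.toLp 2 ![0, (Real.sqrt 2)⁻¹, (Real.sqrt 2)⁻¹] :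
        EuclideanSpace ℝ (Fin 3))⟫_ℝ t := fun t => by
      have := ((hxd t).hasDerivAt).inner ℝ (hasDerivAt_const t
        (WithLp.toLp 2 ![0, (Real.sqrt 2)⁻¹, (Real.sqrt 2)⁻¹] : EuclideanSpace ℝ (Fin 3)))
      simpa using this
    have hg' : ∀ t, 99 / 100 ≤ deriv (fun s => ⟪x s, (WithLp.toLp 2 ![0, (Real.sqrt 2)⁻¹, (Real.sqrt 2)⁻¹] :
        EuclideanSpace ℝ (Fin 3))⟫_ℝ) t := fun t => by
      rw [(hg t).deriv]
      have hsq : ‖deriv x t - WithLp.toLp 2 ![0, (Real.sqrt 2)⁻¹, (Real.sqrt 2)⁻¹]‖ ^ 2 =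
          2 - 2 * ⟪deriv x t, (WithLp.toLp 2 ![0, (Real.sqrt 2)⁻¹, (Real.sqrt 2)⁻¹] : EuclideanSpace ℝ (Fin 3))⟫_ℝ := by
        rw [norm_sub_sq_real, hxu t, he1]; ring
      nlinarith only [norm_nonneg (deriv x t - WithLp.toLp 2 ![0, (Real.sqrt 2)⁻¹, (Real.sqrt 2)⁻¹]), hsq, hnear t]
    have hmv := Convex.mul_sub_le_image_sub_of_le_deriv convex_univ
      (fun t _ => (hg t).continuousAt.continuousWithinAt)
      (fun t _ => (hg t).differentiableAt.differentiableWithinAt) (fun t _ => hg' t)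
    have hcs : |⟪x τ, (WithLp.toLp 2 ![0, (Real.sqrt 2)⁻¹, (Real.sqrt 2)⁻¹] : EuclideanSpace ℝ (Fin 3))⟫_ℝ -
        ⟪x σ, (WithLp.toLp 2 ![0, (Real.sqrt 2)⁻¹, (Real.sqrt 2)⁻¹] : EuclideanSpace ℝ (Fin 3))⟫_ℝ| ≤ ‖x τ - x σ‖ := by
      rw [← inner_sub_left]
      calc _ ≤ ‖x τ - x σ‖ * ‖(WithLp.toLp 2 ![0, (Real.sqrt 2)⁻¹, (Real.sqrt 2)⁻¹] : EuclideanSpace ℝ (Fin 3))‖ :=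
            abs_real_inner_le_norm _ _
        _ = ‖x τ - x σ‖ := by rw [he1, mul_one]
    rcases le_or_gt σ τ with hle | hle
    · have h := hmv σ (mem_univ _) τ (mem_univ _) hle
      rw [abs_of_nonneg (by linarith : 0 ≤ τ - σ)]
      have := le_abs_self (⟪x τ, (WithLp.toLp 2 ![0, (Real.sqrt 2)⁻¹, (Real.sqrt 2)⁻¹] : EuclideanSpace ℝ (Fin 3))⟫_ℝ -
        ⟪x σ, (WithLp.toLp 2 ![0, (Real.sqrt 2)⁻¹, (Real.sqrt 2)⁻¹] : EuclideanSpace ℝ (Fin 3))⟫_ℝ)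
      linarith
    · have h := hmv τ (mem_univ _) σ (mem_univ _) hle.le
      rw [abs_of_neg (by linarith : τ - σ < 0)]
      have := neg_abs_le (⟪x τ, (WithLp.toLp 2 ![0, (Real.sqrt 2)⁻¹, (Real.sqrt 2)⁻¹] : EuclideanSpace ℝ (Fin 3))⟫_ℝ -
        ⟪x σ, (WithLp.toLp 2 ![0, (Real.sqrt 2)⁻¹, (Real.sqrt 2)⁻¹] : EuclideanSpace ℝ (Fin 3))⟫_ℝ)
      linarith
  -- MODEL tangency on the ball with the TRUE partner field
  have htan : ∀ t, ‖x t‖ ≤ Rb * Real.sqrt (Γ * Real.log Γ) →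
      ((1 / 2 : ℝ) • x t - (21 / 5 : ℝ) • cross (EuclideanSpace.single 2 1) (x t)) + f t +
          η⁻¹ • cross (deriv x t) (iteratedDeriv 2 x t) = w t • deriv x t := by
    intro t ht
    have ht' : |t| ≤ 11 / 10 * (Rb * Real.sqrt (Γ * Real.log Γ)) := by
      have := hrad t
      nlinarith only [this, ht, hS₂0]
    have hχt : χ t = 1 := hχ1 t ht'
    have hode' : iteratedDeriv 2 x t = η • cross (deriv x t)
        ((1 / 2 : ℝ) • x t - (21 / 5 : ℝ) • cross (EuclideanSpace.single 2 1) (x t) + f t) := by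
      rw [hxode t, hχt, mul_one]
    have h := liaModel_tangency η (21 / 5) hη0.ne' (deriv x t) (x t) (f t) (iteratedDeriv 2 x t) (hxu t) hode'
    calc ((1 / 2 : ℝ) • x t - (21 / 5 : ℝ) • cross (EuclideanSpace.single 2 1) (x t)) + f t +
          η⁻¹ • cross (deriv x t) (iteratedDeriv 2 x t)
        = η⁻¹ • cross (deriv x t) (iteratedDeriv 2 x t) + f t +
            ((1 / 2 : ℝ) • x t - (21 / 5 : ℝ) • cross (EuclideanSpace.single 2 1) (x t)) := by abel
      _ = _ := h
  -- waist and tilt at the zero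
  have hwaist : ‖x c₀‖ ≤ 1 / 2 * Real.sqrt Γ := by
    have hd := arc_displacement_le (θ := 1 / 3000) hxd hx0 hnear c₀
    have hℓ2 := norm_sq_line Γ c₀ hΓ0.le
    have hLn := norm_nonneg ((WithLp.toLp 2 ![Real.sqrt Γ / 5, 0, 0] : EuclideanSpace ℝ (Fin 3)) +
      c₀ • WithLp.toLp 2 ![0, (Real.sqrt 2)⁻¹, (Real.sqrt 2)⁻¹])
    have hG2 : Real.sqrt Γ ^ 2 = Γ := Real.sq_sqrt hΓ0.le
    have hL2 : ‖(WithLp.toLp 2 ![Real.sqrt Γ / 5, 0, 0] : EuclideanSpace ℝ (Fin 3)) +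
        c₀ • WithLp.toLp 2 ![0, (Real.sqrt 2)⁻¹, (Real.sqrt 2)⁻¹]‖ ^ 2 ≤ (493 / 1000 * Real.sqrt Γ) ^ 2 := by
      rw [hℓ2]; nlinarith only [hG2, hc1, hc2, hG]
    have hLle : ‖(WithLp.toLp 2 ![Real.sqrt Γ / 5, 0, 0] : EuclideanSpace ℝ (Fin 3)) +
        c₀ • WithLp.toLp 2 ![0, (Real.sqrt 2)⁻¹, (Real.sqrt 2)⁻¹]‖ ≤ 493 / 1000 * Real.sqrt Γ :=
      (abs_le_of_sq_le_sq' hL2 (by positivity)).2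
    have hcabs : |c₀| ≤ 9 / 20 * Real.sqrt Γ := by rw [abs_of_neg (by nlinarith only [hc2, hG])]; linarith only [hc1]
    have htri : ‖x c₀‖ ≤ ‖(WithLp.toLp 2 ![Real.sqrt Γ / 5, 0, 0] : EuclideanSpace ℝ (Fin 3)) +
        c₀ • WithLp.toLp 2 ![0, (Real.sqrt 2)⁻¹, (Real.sqrt 2)⁻¹]‖ + 1 / 3000 * |c₀| := by
      have := norm_add_le ((WithLp.toLp 2 ![Real.sqrt Γ / 5, 0, 0] : EuclideanSpace ℝ (Fin 3)) +
        c₀ • WithLp.toLp 2 ![0, (Real.sqrt 2)⁻¹, (Real.sqrt 2)⁻¹])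
        (x c₀ - ((WithLp.toLp 2 ![Real.sqrt Γ / 5, 0, 0] : EuclideanSpace ℝ (Fin 3)) +
          c₀ • WithLp.toLp 2 ![0, (Real.sqrt 2)⁻¹, (Real.sqrt 2)⁻¹]))
      rw [add_sub_cancel] at this
      linarith only [this, hd]
    linarith only [htri, hLle, hcabs, hG]
  have htilt : |⟪deriv x c₀, EuclideanSpace.single 2 1⟫_ℝ| ≤ 1 - 1 / 5 := by
    have he3 : ‖(EuclideanSpace.single (2 : Fin 3) (1 : ℝ) : EuclideanSpace ℝ (Fin 3))‖ = 1 := by simp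
    have hsplit : ⟪deriv x c₀, EuclideanSpace.single 2 1⟫_ℝ =
        ⟪(WithLp.toLp 2 ![0, (Real.sqrt 2)⁻¹, (Real.sqrt 2)⁻¹] : EuclideanSpace ℝ (Fin 3)),
          EuclideanSpace.single 2 1⟫_ℝ +
        ⟪deriv x c₀ - WithLp.toLp 2 ![0, (Real.sqrt 2)⁻¹, (Real.sqrt 2)⁻¹], EuclideanSpace.single 2 1⟫_ℝ := by
      rw [← inner_add_left, add_sub_cancel]
    have he : ⟪(WithLp.toLp 2 ![0, (Real.sqrt 2)⁻¹, (Real.sqrt 2)⁻¹] : EuclideanSpace ℝ (Fin 3)),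
        EuclideanSpace.single 2 1⟫_ℝ = (Real.sqrt 2)⁻¹ := by
      rw [single_two_eq_vec3, inner_vec3]; ring
    have hrest : |⟪deriv x c₀ - WithLp.toLp 2 ![0, (Real.sqrt 2)⁻¹, (Real.sqrt 2)⁻¹],
        (EuclideanSpace.single 2 1 : EuclideanSpace ℝ (Fin 3))⟫_ℝ| ≤ 1 / 3000 := by
      calc _ ≤ ‖deriv x c₀ - WithLp.toLp 2 ![0, (Real.sqrt 2)⁻¹, (Real.sqrt 2)⁻¹]‖ *
            ‖(EuclideanSpace.single (2 : Fin 3) (1 : ℝ) : EuclideanSpace ℝ (Fin 3))‖ := abs_real_inner_le_norm _ _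
        _ ≤ 1 / 3000 := by rw [he3, mul_one]; exact hnear c₀
    obtain ⟨hs1, hs2⟩ := sqrt_two_bounds
    have hinv : (Real.sqrt 2)⁻¹ ≤ 0.70711 := by
      rw [inv_le_comm₀ (by positivity) (by norm_num)]; nlinarith only [hs1, hs2]
    have hinv0 : 0 ≤ (Real.sqrt 2)⁻¹ := by positivity
    rw [hsplit, he]
    have := abs_add_le ((Real.sqrt 2)⁻¹) (⟪deriv x c₀ - WithLp.toLp 2 ![0, (Real.sqrt 2)⁻¹, (Real.sqrt 2)⁻¹],
        (EuclideanSpace.single 2 1 : EuclideanSpace ℝ (Fin 3))⟫_ℝ)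
    rw [abs_of_nonneg hinv0] at this
    linarith only [this, hrest, hinv]
  exact ⟨χ, x, f, w, c₀, ⟨hχs, hχ1, hχ0, hχ01⟩, ⟨fun t => rfl, hxc, hx0, hx0', hxu, hxode⟩, ⟨hnear, hcurv, harm⟩,
    ⟨hrad, hproper, hchord, hsep⟩, ⟨hw, hwc, htan⟩, ⟨hneg, hpos, hc₀, hc1, hc2, hwaist, htilt, hposR⟩⟩

end SelectionBoxRJRung

end Summit.NavierStokesRegularity.NavierStokesRegularity.Theorems
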